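import Literature.NumberTheory.Automorphic.HyperspecialUnitarySatakeInjective
import Literature.NumberTheory.Automorphic.HyperspecialUnitaryCartanAdicCompletion
import Literature.NumberTheory.Automorphic.HeckePairsValuedFiniteResidueField
import Literature.NumberTheory.Automorphic.AdicCompletionCompact
import HarnessLib

/-!
# The split orthogonal group `O_N(J₀)` is the case `σ = id` of the tree's hyperspecial unitary theory: the
# unramified datum for `σ = id` at every non-dyadic place (O'Meara §63A; Serre V §2; Tits 1979, §3.3.3; Satake 1963, §8–§9)

Topic `NumberTheory/Automorphic`; namespace `Literature.NumberTheory.Automorphic` (lane `lit-hodgefound`, Track 2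
foundations; seat `lit-hodgefound-p11`, generation 38, row g38-#6).  THEOREMS ONLY: no definition, no named fact, no
instance, no notation.  Pointer (x6) of generation 37: «the abstract layer applies verbatim to any further datum (split
`O_N` via the symmetric `StdForm.antidiagonal`)».

The tree's unramified local theory of the quasi-split unitary group `U(σ, J₀) = unitaryGroupOfForm σ J₀`,
`J₀ = antidiag(1, …, 1)` (`StdForm.antidiagonal N`), at a hyperspecial `K₀ = U(σ, J₀) ∩ GL_N(𝒪)` —
`HermitianLatticesLocal` (the datum `UnramifiedLocalConjDatum σ ϖ`), `HyperspecialUnitaryIwasawa` (Iwasawa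
`G = B K₀`), `HyperspecialUnitaryCartan` (Cartan), `HyperspecialUnitaryIwasawaExponents`, `…SatakeTransform`,
`…SatakeInjective` (the Satake transform `𝒮` in the `δ^{1/2}` normalisation and its injectivity), `…HeckeEigencharacter` —
is stated for an ARBITRARY ring endomorphism `σ` subject to the datum: `σ` an involution preserving the valuation, `ϖ` a
`σ`-fixed uniformiser, (trace) `t + σ t = 1` for some integral `t`, (norm) `σ`-fixed `1`-units are norms `z σ z`.  For
`σ = id` the group `U(id, J₀) = {g ∣ gᵀ J₀ g = J₀}` IS THE SPLIT ORTHOGONAL GROUP `O_N(J₀)` (Witt index `⌊N/2⌋`), (trace)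
reads `2t = 1` (non-dyadic) and (norm) reads «`1`-units are squares» — O'Meara's Local Square Theorem: «63:1. Let `α`
be an integer […] with `|α| < |4|?`… `|1 − α| < 1`… then `α` is a square» in its non-dyadic form, i.e. Hensel's lemma for
`X² − u`.  So every theorem of the chain holds for `O_N(J₀)` over a non-dyadic henselian discretely valued field, in
particular at every finite place `w ∤ 2` of a number field (Satake 1963, §§8–9: the orthogonal groups are among the
classical groups of his theory; Tits 1979, §3.3.3: `K₀` is hyperspecial).

## What is formalised (theorems only; `O_N(J₀)(K) = unitaryGroupOfForm (RingHom.id K) ((StdForm.antidiagonal N).over K)`)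

* §1 (any `ℤᵐ⁰`-valued field `K`) `mem_unitaryGroupOfForm_id_iff_transpose_mul` (`U(id, H) = O(H)`: `g ∈ U(id, H) ↔ gᵀ H g = H`),
  **`localConjDatum_id`** / **`unramifiedLocalConjDatum_id`** (the datum for `σ = id` from: `ϖ` a uniformiser, `|2| = 1`,
  `1`-units are squares), **`exists_eq_upper_mul_orthogonalInt`** (IWASAWA `O_N(J₀)(K) = B · (O_N(J₀) ∩ GL_N(𝒪))` for EVERY
  `K` — the tree's `exists_eq_upper_mul_unitaryInt` needs only `σσ = 1` and `|σ x| = |x|`),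
  `isHeckeTriple_orthogonalInt_of_finite_residueField` (the Hecke pair, from g38-#2, uniformiser + finite residue field).
* §2 (a number field `E`, a finite place `w ∤ 2`) `valued_two_adicCompletion_eq_one` (`|2|_w = 1`),
  **`exists_localConjDatum_id_adicCompletion`**, **`exists_unramifiedLocalConjDatum_id_adicCompletion`** (THE DATUM FOR
  `O_N(J₀)(E_w)`: every `hd.`-theorem of the unitary chain now applies to the split orthogonal group at `w`).
* §3 (consequences at `w ∤ 2`, read off the chain) **`splitOrthogonal_exists_cartan`** (CARTAN: `k₁ g k₂ = diag(d)`,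
  `d_i d_{N-1-i} = 1`, `k₁, k₂ ∈ O_N(J₀) ∩ GL_N(𝒪_w)`), **`splitOrthogonal_satakeTransform_injective`** (the Satake
  transform `𝒮 : ℋ(O_N(J₀)(E_w), K₀) → ℂ[ℤ^N]` of the datum is injective; `Finite 𝓀[E_w]` from
  `finite_residueField_adicCompletion`), `splitOrthogonal_isHeckeTriple` (the Hecke pair `(O_N(J₀)(E_w), K₀)`).

## References
* [Omeara1963] O. T. O'Meara, *Introduction to Quadratic Forms* (1963), §63A (63:1) (Local Square Theorem).
* [Serre1979] J.-P. Serre, *Local Fields* (1979), Ch. V §2 Prop. 3 (units of unramified extensions), Ch. II §4.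
* [Tits1979] J. Tits, *Reductive groups over local fields*, PSPM 33.1 (1979), §3.3.3 (hyperspecial points of classical groups).
* [Satake1963] I. Satake, Publ. Math. IHÉS 18 (1963), §§8–9 (the classical groups).
* [CartierCorvallis1979] P. Cartier, PSPM 33.1 (1979), §IV Thm. 4.1.
-/

noncomputable section

open scoped Valued WithZero Matrix MatrixGroups
open NumberField IsDedekindDomain

namespace Literature.NumberTheory.Automorphic

open Literature.NumberTheory.Automorphic.HermitianLattice Literature.NumberTheory.Automorphic.UnitaryGroup

/-! ## §1 The datum for `σ = id` over a `ℤᵐ⁰`-valued field -/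

section General

variable {K : Type*} [Field K] [Valued K ℤᵐ⁰] {ϖ : K} {N : ℕ}

omit [Valued K ℤᵐ⁰] in
/-- **`U(id, H) = O(H)`**: membership in the tree's `unitaryGroupOfForm` for the identity endomorphism is `gᵀ H g = H`,
the orthogonal group of the symmetric form `H`. [cite: Satake1963, §8] [cite: Tits1979, §3.3.3] -/
theorem mem_unitaryGroupOfForm_id_iff_transpose_mul {n : Type*} [Fintype n] [DecidableEq n] (H : Matrix n n K) (g : GL n K) :
    g ∈ unitaryGroupOfForm (RingHom.id K) H ↔ (g : Matrix n n K)ᵀ * H * (g : Matrix n n K) = H := by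
  rw [mem_unitaryGroupOfForm_iff, RingHom.coe_id, Matrix.map_id]

/-- **The non-dyadic local conjugation datum for `σ = id`**: a uniformiser `ϖ`, `|2| = 1`, and «`1`-units are squares»
(the Local Square Theorem / Hensel for `X² - u`) — the remaining axioms (`σσ = 1`, `|σ x| = |x|`, `σ ϖ = ϖ`) are
trivial for the identity. [cite: Omeara1963, §63A (63:1)] -/
theorem localConjDatum_id (hϖ : Valued.v ϖ = WithZero.exp (-1 : ℤ)) (h2 : Valued.v (2 : K) = 1)
    (hsqrt : ∀ u : K, Valued.v (u - 1) < 1 → ∃ s : K, s ^ 2 = u ∧ Valued.v (s - 1) < 1) :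
    LocalConjDatum (RingHom.id K) ϖ :=
  ⟨fun _ => rfl, fun _ => rfl, rfl, hϖ, h2, hsqrt⟩

/-- **The unramified datum for `σ = id`** ((trace) with `t = ½`, (norm) `u = s · s` with the Hensel square root `s`).
[cite: Omeara1963, §63A (63:1)] [cite: Serre1979, Ch. V §2 Prop. 3] -/
theorem unramifiedLocalConjDatum_id (hϖ : Valued.v ϖ = WithZero.exp (-1 : ℤ)) (h2 : Valued.v (2 : K) = 1)
    (hsqrt : ∀ u : K, Valued.v (u - 1) < 1 → ∃ s : K, s ^ 2 = u ∧ Valued.v (s - 1) < 1) :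
    UnramifiedLocalConjDatum (RingHom.id K) ϖ :=
  (localConjDatum_id hϖ h2 hsqrt).toUnramified

/-- **IWASAWA DECOMPOSITION OF THE SPLIT ORTHOGONAL GROUP over every `ℤᵐ⁰`-valued field**:
`O_N(J₀)(K) = B · (O_N(J₀) ∩ GL_N(𝒪))`, `B` the upper triangular subgroup — the tree's `exists_eq_upper_mul_unitaryInt`
at `σ = id` (it only uses `σσ = 1` and `|σ x| = |x|`). [cite: Tits1979, §3.3.2, §3.3.3] [cite: CartierCorvallis1979, §IV (4.2)] -/
theorem exists_eq_upper_mul_orthogonalInt (g : unitaryGroupOfForm (RingHom.id K) ((StdForm.antidiagonal N).over K)) :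
    ∃ b : unitaryGroupOfForm (RingHom.id K) ((StdForm.antidiagonal N).over K),
      ∃ k ∈ unitaryInt (RingHom.id K) ((StdForm.antidiagonal N).over K),
        ((b : GL (Fin N) K) : Matrix (Fin N) (Fin N) K).BlockTriangular id ∧ g = b * k :=
  exists_eq_upper_mul_unitaryInt (σ := RingHom.id K) (fun _ => rfl) (fun _ => rfl) g

/-- **`(O_N(J₀)(K), O_N(J₀) ∩ GL_N(𝒪))` is a Hecke pair** for every `ℤᵐ⁰`-valued field with a uniformiser and finite
residue field (g38-#2 `isHeckeTriple_unitaryInt_of_finite_residueField` at `σ = id`; no compactness).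
[cite: Satake1963, §8] [cite: ShimuraIATAF1971, §3.2 Lemma 3.10] -/
theorem isHeckeTriple_orthogonalInt_of_finite_residueField (hϖ : Valued.v ϖ = WithZero.exp (-1 : ℤ)) [Finite 𝓀[K]]
    {n : Type*} [Fintype n] [DecidableEq n] (H : Matrix n n K) :
    IsHeckeTriple (⊤ : Submonoid (unitaryGroupOfForm (RingHom.id K) H)) (unitaryInt (RingHom.id K) H)
      (unitaryInt (RingHom.id K) H) :=
  isHeckeTriple_unitaryInt_of_finite_residueField hϖ (RingHom.id K) H

end General

/-! ## §2 The datum at the non-dyadic places of a number field -/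

section NumberField

variable {E : Type} [Field E] [NumberField E] (w : HeightOneSpectrum (𝓞 E)) {N : ℕ}

/-- `|2|_w = 1` at a place `w ∤ 2`. [cite: Omeara1963, §63A] -/
theorem valued_two_adicCompletion_eq_one (h2 : (2 : 𝓞 E) ∉ w.asIdeal) : Valued.v (2 : w.adicCompletion E) = 1 := by
  have e1 : (algebraMap E (w.adicCompletion E)) (algebraMap (𝓞 E) E 2) = 2 := by rw [map_ofNat, map_ofNat]
  rw [← e1]
  change Valued.v ((algebraMap (𝓞 E) E 2 : E) : w.adicCompletion E) = 1
  rw [HeightOneSpectrum.valuedAdicCompletion_eq_valuation', HeightOneSpectrum.valuation_of_algebraMap]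
  exact HeightOneSpectrum.intValuation_eq_one_iff.2 h2

/-- **The non-dyadic datum for `σ = id` at `E_w`, `w ∤ 2`**: a uniformiser of `E` at `w`, `|2|_w = 1`, and Hensel square
roots of `1`-units in the complete field `E_w` (the tree's `exists_sq_eq_of_valued_sub_one_lt`).
[cite: Omeara1963, §63A (63:1)] [cite: Serre1979, Ch. II §4] -/
theorem exists_localConjDatum_id_adicCompletion (h2 : (2 : 𝓞 E) ∉ w.asIdeal) :
    ∃ ϖ : w.adicCompletion E, LocalConjDatum (RingHom.id (w.adicCompletion E)) ϖ := by
  obtain ⟨π, hπ⟩ := HeightOneSpectrum.valuation_exists_uniformizer E w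
  refine ⟨(π : w.adicCompletion E), localConjDatum_id ?_ (valued_two_adicCompletion_eq_one w h2)
    (exists_sq_eq_of_valued_sub_one_lt w (valued_two_adicCompletion_eq_one w h2))⟩
  rw [HeightOneSpectrum.valuedAdicCompletion_eq_valuation', hπ]

/-- **THE UNRAMIFIED DATUM FOR THE SPLIT ORTHOGONAL GROUP `O_N(J₀)(E_w)` AT EVERY `w ∤ 2`** — so every
`UnramifiedLocalConjDatum.…` theorem of the hyperspecial unitary chain (Iwasawa exponents, Cartan, Satake transform and
its injectivity, Hecke eigencharacters, degrees) holds for `σ = id`. [cite: Omeara1963, §63A (63:1)]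
[cite: Serre1979, Ch. V §2 Prop. 3] [cite: Tits1979, §3.3.3] -/
theorem exists_unramifiedLocalConjDatum_id_adicCompletion (h2 : (2 : 𝓞 E) ∉ w.asIdeal) :
    ∃ ϖ : w.adicCompletion E, UnramifiedLocalConjDatum (RingHom.id (w.adicCompletion E)) ϖ := by
  obtain ⟨ϖ, hd⟩ := exists_localConjDatum_id_adicCompletion w h2
  exact ⟨ϖ, hd.toUnramified⟩

/-! ## §3 Consequences for `O_N(J₀)(E_w)`, `w ∤ 2` -/

/-- **CARTAN DECOMPOSITION OF `O_N(J₀)(E_w)`, `w ∤ 2`**: for `g ∈ O_N(J₀)(E_w)` there are `k₁, k₂ ∈ O_N(J₀)` with integral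
entries and integral inverses and `d` with `k₁ g k₂ = diag(d)`, `d_i d_{N-1-i} = 1` (the chain's
`exists_cartan_antidiagonal` at the `σ = id` datum). [cite: Tits1979, §3.3.3] [cite: Satake1963, §8–§9] -/
theorem splitOrthogonal_exists_cartan (h2 : (2 : 𝓞 E) ∉ w.asIdeal) (g : GL (Fin N) (w.adicCompletion E))
    (hg : g ∈ unitaryGroupOfForm (RingHom.id (w.adicCompletion E)) ((StdForm.antidiagonal N).over (w.adicCompletion E))) :
    ∃ k₁ k₂ : GL (Fin N) (w.adicCompletion E),
      k₁ ∈ unitaryGroupOfForm (RingHom.id (w.adicCompletion E)) ((StdForm.antidiagonal N).over (w.adicCompletion E)) ∧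
      (∀ i j, Valued.v ((k₁ : Matrix (Fin N) (Fin N) (w.adicCompletion E)) i j) ≤ 1) ∧
      (∀ i j, Valued.v (((k₁⁻¹ : GL (Fin N) (w.adicCompletion E)) : Matrix (Fin N) (Fin N) (w.adicCompletion E)) i j) ≤ 1) ∧
      k₂ ∈ unitaryGroupOfForm (RingHom.id (w.adicCompletion E)) ((StdForm.antidiagonal N).over (w.adicCompletion E)) ∧
      (∀ i j, Valued.v ((k₂ : Matrix (Fin N) (Fin N) (w.adicCompletion E)) i j) ≤ 1) ∧
      (∀ i j, Valued.v (((k₂⁻¹ : GL (Fin N) (w.adicCompletion E)) : Matrix (Fin N) (Fin N) (w.adicCompletion E)) i j) ≤ 1) ∧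
      ∃ d : Fin N → w.adicCompletion E,
        ((k₁ * g * k₂ : GL (Fin N) (w.adicCompletion E)) : Matrix (Fin N) (Fin N) (w.adicCompletion E)) =
          Matrix.diagonal d ∧ ∀ i, d i * d (Fin.rev i) = 1 := by
  obtain ⟨ϖ, hd⟩ := exists_unramifiedLocalConjDatum_id_adicCompletion w h2
  obtain ⟨k₁, k₂, h1, h2', h3, h4, h5, h6, d, hdiag, -, hd1⟩ := hd.exists_cartan_antidiagonal g hg
  exact ⟨k₁, k₂, h1, h2', h3, h4, h5, h6, d, hdiag, hd1⟩

/-- **THE SATAKE TRANSFORM OF `ℋ(O_N(J₀)(E_w), K₀)` IS INJECTIVE**, `w ∤ 2` (for any `σ = id` datum `hd`; residue-field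
finiteness from `finite_residueField_adicCompletion`). [cite: CartierCorvallis1979, §IV Thm. 4.1] [cite: Satake1963, §8–§9] -/
theorem splitOrthogonal_satakeTransform_injective {ϖ : w.adicCompletion E}
    (hd : UnramifiedLocalConjDatum (RingHom.id (w.adicCompletion E)) ϖ) :
    haveI := finite_residueField_adicCompletion E w
    Function.Injective (hd.satakeTransform (N := N)) :=
  haveI := finite_residueField_adicCompletion E w
  hd.satakeTransform_injective

/-- **`(O_N(J₀)(E_w), O_N(J₀) ∩ GL_N(𝒪_w))` is a Hecke pair** at every finite place `w` (g38-#2 with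
`finite_residueField_adicCompletion`; no parity condition). [cite: Satake1963, §8] [cite: ShimuraIATAF1971, §3.2 Lemma 3.10] -/
theorem splitOrthogonal_isHeckeTriple :
    IsHeckeTriple (⊤ : Submonoid (unitaryGroupOfForm (RingHom.id (w.adicCompletion E))
        ((StdForm.antidiagonal N).over (w.adicCompletion E))))
      (unitaryInt (RingHom.id (w.adicCompletion E)) ((StdForm.antidiagonal N).over (w.adicCompletion E)))
      (unitaryInt (RingHom.id (w.adicCompletion E)) ((StdForm.antidiagonal N).over (w.adicCompletion E))) := by
  obtain ⟨π, hπ⟩ := HeightOneSpectrum.valuation_exists_uniformizer E w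
  haveI := finite_residueField_adicCompletion E w
  have hϖ : Valued.v (π : w.adicCompletion E) = WithZero.exp (-1 : ℤ) := by
    rw [HeightOneSpectrum.valuedAdicCompletion_eq_valuation', hπ]
  exact isHeckeTriple_unitaryInt_of_finite_residueField hϖ (RingHom.id _) _

end NumberField

end Literature.NumberTheory.Automorphic

end
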